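import Literature.AlgebraicGeometry.Motives.ProjectiveSpaceSections
import Literature.AlgebraicGeometry.Motives.CartierDivisorEffective
import Mathlib.Algebra.Module.Submodule.Union
import HarnessLib

/-!
# Hypersurfaces of projective space as effective Cartier divisors: `V₊(F) = e • H + div(F/x₀ᵉ)`

In the concrete divisor model of this directory (`Motives/CartierDivisor`: Cartier divisors on an
integral scheme presented by local equations in the function field; `Motives/ProjectiveSpaceSections`:
the hyperplane divisor `H = {x₀ = 0}` on `ℙ^d_K = Proj K[x₀, …, x_d]` and the sections
`F/x₀ᵉ ∈ Γ(ℙ^d, 𝒪(e • H))` of forms `F` of degree `e`), this file provides the divisor calculus of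
hypersurfaces of `ℙ^d` needed to intersect cycles on `ℙ^d` with (generic) hyperplanes
(Fulton, *Intersection Theory*, Ch. 2, on `ℙ^d`):

* `ProjSpace.isUnitAt_formToFunctionField_iff` — **units of the local rings**: for `y ∈ D₊(x_l)` and a
  form `F` of degree `e ≥ 1`, the rational function `F/x_lᵉ` is a unit of `𝒪_{ℙ^d, y}` iff `F ∉ 𝔭_y`
  (`D₊(x_l) ∩ X_{F/x_lᵉ} = D₊(x_l) ∩ D₊(F)`, `basicOpen_sec_mk`, from Mathlib's
  `Proj.awayι_preimage_basicOpen`);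
* `ProjSpace.exists_forms_eq_div_of_isUnitAt` — **every unit of `𝒪_{ℙ^d, y}` is a ratio `F/G` of two
  forms of the same degree `e ≥ 1` not in `𝔭_y`** (`𝒪_{ℙ^d,y} = K[x]_{(𝔭_y)}`, Hartshorne II
  Prop. 2.5 (a); here from `Γ(D₊(x_l), 𝒪) = (K[x]_{(x_l)})₀` and `Γ(D(r), 𝒪) = Γ(D₊(x_l), 𝒪)[r⁻¹]`);
* `ProjSpace.formDivisor F` — **the hypersurface `V₊(F)` as the Cartier divisor `e • H + div(F/x₀ᵉ)`**
  (the divisor of zeros of the section `F/x₀ᵉ`, Hartshorne II Prop. 7.7 (a); Görtz–Wedhorn I,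
  Example 11.45), with local equation `F/x_lᵉ` on `D₊(x_l)` (`formDivisor_f`), effective
  (`isEffective_formDivisor`), linearly equivalent to `e • H` (`smul_hyperplane_linEquiv_formDivisor`; for
  a linear form, to `H`: `hyperplane_linEquiv_formDivisor`), and with **support `V₊(F)`**:
  `formDivisor F` avoids `y` iff `F ∉ 𝔭_y` (`formDivisor_avoids_iff`); `isEffective_hyperplane`;
* `ProjSpace.exists_linearForm_forall_notMem` — **generic hyperplanes**: over an infinite field, for a
  finite set `B ⊆ ℙ^d` there is a nonzero linear form `ℓ` with `ℓ ∉ 𝔭_b` for all `b ∈ B` (a vector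
  space over an infinite field is not a finite union of proper subspaces, Mathlib
  `Submodule.exists_forall_notMem_of_forall_ne_top`; the primes `𝔭_b` are relevant, `exists_X_notMem`).

Everything is proved; no named facts. Written toward the operation `c₁(𝒪(1)) ∩ -` on the Chow groups
of `ℙ^d` by generic hyperplane sections (Fulton, §2.5 and Thm. 2.4, Case 1 on `ℙ^d`), for the
non-torsion of the classes of linear subspaces (`Motives/LinearSubspacesGenerateChow`,
`Mboro2018_chowTwo_cubic`).

## References

* U. Görtz, T. Wedhorn, *Algebraic Geometry I: Schemes*, 2nd ed., Springer Spektrum (2020),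
  doi:10.1007/978-3-658-30733-2: Example 11.45 (divisors on `ℙⁿ_k`, `𝒪(n)`), (11.12.3) and Remark
  11.27 (effective divisors and sections), (13.4) (the charts `(K[x]_{(x_l)})₀`). [GortzWedhorn2020]
* R. Hartshorne, *Algebraic Geometry*, GTM 52 (1977): II Prop. 2.5 (a) (local rings of `Proj`),
  II Prop. 7.7 (a) (divisor of zeros of a section). [Hartshorne1977]
* W. Fulton, *Intersection Theory*, 2nd ed., Springer (1998), §2.5, Thm. 2.4. [Fulton1998]
-/

universe u

open CategoryTheory AlgebraicGeometry Limits HomogeneousLocalization TopologicalSpace Opposite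
open MvPolynomial (X C)
open Literature.AlgebraicGeometry.Motives.Segre Literature.AlgebraicGeometry.Motives.RatFn

attribute [local instance] MvPolynomial.gradedAlgebra

noncomputable section

namespace Literature.AlgebraicGeometry.Motives

namespace ProjSpace

variable {d : ℕ} {K : Type u} [Field K]

/-! ### Units among the rational functions of a chart -/

/-- `(𝟙 ℙ^d)⁻¹ D₊(x_l) ↪ ℙ^d` factors as `chartLift ≫ chartι` (unfolding of
`GeneratingSections.chartLift_chartι` for `r = 𝟙`). [folklore] -/
theorem chartLift_chartι_id (l : Fin (d + 1)) :
    GeneratingSections.chartLift (𝟙 (P d K)) l ≫ chartι K l = (U l).ι := by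
  rw [GeneratingSections.chartLift_chartι, Category.comp_id]

/-- **The non-vanishing locus of the section of `F/x_lᵉ` over `D₊(x_l)` is `D₊(x_l) ∩ D₊(F)`**
(`e ≥ 1`). [folklore] -/
theorem basicOpen_sec_mk (l : Fin (d + 1)) {e : ℕ} (he : 0 < e) {F : MvPolynomial (Fin (d + 1)) K}
    (hF : F ∈ grading (Fin (d + 1)) K e) :
    (P d K).basicOpen (sec l (Away.mk _ (X_mem K l) e F (mem_smul_one hF))) =
      U l ⊓ Proj.basicOpen (grading (Fin (d + 1)) K) F := by
  rw [sec]
  have h1 : (P d K).basicOpen ((U l).topIso.hom (pull (GeneratingSections.chartLift (𝟙 (P d K)) l)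
      (Away.mk _ (X_mem K l) e F (mem_smul_one hF)))) =
      (U l).ι ''ᵁ (U l : Scheme.{u}).basicOpen (pull (GeneratingSections.chartLift (𝟙 (P d K)) l)
        (Away.mk _ (X_mem K l) e F (mem_smul_one hF))) := by
    rw [← Scheme.Opens.ι_image_basicOpen_topIso_inv, ← CommRingCat.comp_apply, Iso.hom_inv_id]
    rfl
  have hF1 : F ^ 1 ∈ grading (Fin (d + 1)) K e := by rw [pow_one]; exact hF
  have h2 : Away.mk _ (X_mem K l) e F (mem_smul_one hF) =
      Away.isLocalizationElem (𝒜 := grading (Fin (d + 1)) K) (X_mem K l) hF := by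
    apply val_injective
    simp only [Away.val_mk, pow_one]
  rw [h1, basicOpen_pull, h2, ← Proj.awayι_preimage_basicOpen _ (X_mem K l) zero_lt_one hF he,
    ← Scheme.Hom.comp_preimage, chartLift_chartι_id, Scheme.Hom.image_preimage_eq_opensRange_inf,
    Scheme.Opens.opensRange_ι]

/-- **Units of a chart**: for `y ∈ D₊(x_l)` and a form `F` of degree `e ≥ 1`, the rational function
`F/x_lᵉ` is a unit at `y` iff `F ∉ 𝔭_y`. [folklore] -/
theorem isUnitAt_awayToFunctionField_mk_iff (l : Fin (d + 1)) {e : ℕ} (he : 0 < e)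
    {F : MvPolynomial (Fin (d + 1)) K} (hF : F ∈ grading (Fin (d + 1)) K e) {y : P d K}
    (hy : y ∈ U l) :
    IsUnitAt y (awayToFunctionField l (Away.mk _ (X_mem K l) e F (mem_smul_one hF))) ↔
      F ∉ y.asHomogeneousIdeal := by
  rw [awayToFunctionField_apply]
  have h := isUnitAt_ofSection_iff hy (sec l (Away.mk _ (X_mem K l) e F (mem_smul_one hF)))
  rw [h, basicOpen_sec_mk l he hF, Opens.mem_inf, ← Proj.mem_basicOpen (𝒜 := grading (Fin (d + 1)) K)]
  exact ⟨fun h' => h'.2, fun h' => ⟨hy, h'⟩⟩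

/-- For a form `F` of degree `e ≥ 1` and `y ∈ D₊(x_l)`: `formToFunctionField l F = F/x_lᵉ` is a
unit at `y` iff `F ∉ 𝔭_y`. [folklore] -/
theorem isUnitAt_formToFunctionField_iff (l : Fin (d + 1)) {e : ℕ} (he : 0 < e)
    {F : MvPolynomial (Fin (d + 1)) K} (hF : F ∈ grading (Fin (d + 1)) K e) {y : P d K}
    (hy : y ∈ U l) :
    IsUnitAt y (formToFunctionField l F) ↔ F ∉ y.asHomogeneousIdeal := by
  rw [formToFunctionField_of_mem l (mem_smul_one hF)]
  exact isUnitAt_awayToFunctionField_mk_iff l he hF hy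

/-- `formToFunctionField l F` is regular on `D₊(x_l)`. [folklore] -/
theorem isRegularAt_formToFunctionField (l : Fin (d + 1)) {e : ℕ}
    {F : MvPolynomial (Fin (d + 1)) K} (hF : F ∈ grading (Fin (d + 1)) K e) {y : P d K}
    (hy : y ∈ U l) : IsRegularAt y (formToFunctionField l F) := by
  rw [formToFunctionField_of_mem l (mem_smul_one hF)]
  exact isRegularAt_awayToFunctionField l _ hy

/-! ### The hyperplane divisor is effective; `(x₀/x_l)ᵉ · F/x₀ᵉ = F/x_lᵉ` -/

/-- The hyperplane divisor `H = {x₀ = 0}` is effective (its local equations `x₀/x_l` are regular on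
`D₊(x_l)`). [folklore] -/
theorem isEffective_hyperplane : (hyperplane d K).IsEffective := by
  intro i y hy
  rw [hyperplane_f]
  exact isRegularAt_awayToFunctionField _ _ hy

/-- In `K(ℙ^d)`: `(x₀/x_l)ᵉ · (F/x₀ᵉ) = F/x_lᵉ` for a form `F` of degree `e`. [folklore] -/
theorem hyperplane_f_pow_mul_formToFunctionField (i : (hyperplane d K).ι) {e : ℕ}
    {F : MvPolynomial (Fin (d + 1)) K} (hF : F ∈ grading (Fin (d + 1)) K e) :
    (hyperplane d K).f i ^ e * formToFunctionField 0 F = formToFunctionField i.down.1 F := by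
  set l := i.down.1 with hl
  rw [hyperplane_f, formToFunctionField_of_mem 0 (mem_smul_one hF),
    formToFunctionField_of_mem l (mem_smul_one hF)]
  obtain ⟨ρ, -, hρl, hρ0⟩ := exists_awayToFunctionField_eq_comp_awayMap (d := d) (K := K) l 0
  rw [hρl, hρ0, RingHom.comp_apply, RingHom.comp_apply, ← map_pow, ← map_mul,
    awayMap_frac_pow_mul_awayMap_mk, ← RingHom.comp_apply]

/-- `F/x₀ᵉ ≠ 0` for a nonzero form `F` of degree `e`. [folklore] -/
theorem formToFunctionField_ne_zero (l : Fin (d + 1)) {e : ℕ} {F : MvPolynomial (Fin (d + 1)) K}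
    (hF : F ∈ grading (Fin (d + 1)) K e) (hF0 : F ≠ 0) : formToFunctionField l F ≠ 0 := by
  rw [formToFunctionField_of_mem l (mem_smul_one hF)]
  intro h
  rw [← map_zero (awayToFunctionField l)] at h
  have h2 := congrArg HomogeneousLocalization.val (awayToFunctionField_injective l h)
  simp only [Away.val_mk, val_zero] at h2
  rw [← Localization.mk_zero (⟨X l ^ e, ⟨e, rfl⟩⟩ : Submonoid.powers (X l : MvPolynomial (Fin (d + 1)) K)),
    Localization.mk_eq_mk_iff, Localization.r_iff_exists] at h2
  obtain ⟨⟨c, hc⟩, e'⟩ := h2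
  obtain ⟨k, rfl⟩ := hc
  simp only [mul_zero, mul_eq_zero, pow_eq_zero_iff', MvPolynomial.X_ne_zero, ne_eq,
    false_and, false_or] at e'
  exact hF0 e'


/-- Two charts give proportional fractions: `F/x_lᵉ · (G/x_lᵉ)⁻¹ = F/x₀ᵉ · (G/x₀ᵉ)⁻¹`, i.e. the
ratio `F/G` of two forms of the same degree is a well defined rational function. [folklore] -/
theorem formToFunctionField_div_eq (l : Fin (d + 1)) {e : ℕ} {F G : MvPolynomial (Fin (d + 1)) K}
    (hF : F ∈ grading (Fin (d + 1)) K e) (hG : G ∈ grading (Fin (d + 1)) K e) :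
    formToFunctionField l F / formToFunctionField l G =
      formToFunctionField 0 F / formToFunctionField 0 G := by
  let i : (hyperplane d K).ι := ⟨⟨l, genericPoint_mem_U l⟩⟩
  rw [← hyperplane_f_pow_mul_formToFunctionField i hF, ← hyperplane_f_pow_mul_formToFunctionField i hG,
    mul_div_mul_left]
  exact pow_ne_zero _ ((hyperplane d K).f_ne_zero i)

/-- Padding a fraction: `(F · x_lᵐ)/x_l^{e+m} = F/x_lᵉ` in `(K[x]_{(x_l)})₀`. [folklore] -/
theorem awayMk_mul_X_pow (l : Fin (d + 1)) {e : ℕ} {F : MvPolynomial (Fin (d + 1)) K}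
    (hF : F ∈ grading (Fin (d + 1)) K (e • 1)) (m : ℕ)
    (hF' : F * X l ^ m ∈ grading (Fin (d + 1)) K ((e + m) • 1)) :
    Away.mk _ (X_mem K l) (e + m) (F * X l ^ m) hF' = Away.mk _ (X_mem K l) e F hF := by
  apply val_injective
  simp only [Away.val_mk]
  rw [Localization.mk_eq_mk_iff, Localization.r_iff_exists]
  exact ⟨1, by simp; ring⟩

/-- `F · x_lᵐ` is a form of degree `e + m` if `F` is one of degree `e`. [folklore] -/
theorem mul_X_pow_mem {l : Fin (d + 1)} {e : ℕ} {F : MvPolynomial (Fin (d + 1)) K}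
    (hF : F ∈ grading (Fin (d + 1)) K e) (m : ℕ) : F * X l ^ m ∈ grading (Fin (d + 1)) K (e + m) := by
  have h : (X l : MvPolynomial (Fin (d + 1)) K) ^ m ∈ grading (Fin (d + 1)) K m := by
    simpa using SetLike.pow_mem_graded m (X_mem K l)
  exact SetLike.mul_mem_graded hF h

/-- **Units of the local rings of `ℙ^d` are ratios of forms not vanishing at the point**: a rational
function `a` which is a unit at `y` is `F/G` for two forms `F, G` of the same degree `e ≥ 1`, neither
of which lies in the homogeneous prime `𝔭_y` (`𝒪_{ℙ^d, y} = K[x]_{(𝔭_y)}`, Hartshorne II Prop. 2.5 (a) /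
Görtz–Wedhorn I, (13.4)). [folklore] -/
theorem exists_forms_eq_div_of_isUnitAt {y : P d K} {a : (P d K).functionField} (ha : IsUnitAt y a) :
    ∃ (e : ℕ) (F G : MvPolynomial (Fin (d + 1)) K), 0 < e ∧ F ∈ grading (Fin (d + 1)) K e ∧
      G ∈ grading (Fin (d + 1)) K e ∧ F ∉ y.asHomogeneousIdeal ∧ G ∉ y.asHomogeneousIdeal ∧
        a = formToFunctionField 0 F / formToFunctionField 0 G := by
  -- a chart `D₊(x_l) ∋ y` and a section `σ` over an open `V ∋ y` with germ the unit `a`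
  obtain ⟨⟨⟨l, hl⟩⟩, hy⟩ := (hyperplane d K).covers y
  change y ∈ U l at hy
  obtain ⟨u, rfl⟩ := ha
  obtain ⟨V, hyV, σ, hσ⟩ := (P d K).presheaf.exists_germ_eq (u : (P d K).presheaf.stalk y)
  -- shrink to a basic open `D(r) ⊆ V ∩ D₊(x_l)` of the affine chart
  have hUaff : IsAffineOpen (U (d := d) (K := K) l) :=
    GeneratingSections.isAffineOpen_ofHom_U (𝟙 (P d K)) l
  obtain ⟨r, hrV, hyr⟩ := hUaff.exists_basicOpen_le (V := V ⊓ U l) ⟨y, Opens.mem_inf.2 ⟨hyV, hy⟩⟩ hy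
  have hrU : (P d K).basicOpen r ≤ U l := (P d K).basicOpen_le r
  haveI := hUaff.isLocalization_basicOpen r
  -- `σ|_{D(r)} · r^n = σ₁|_{D(r)}` with `σ₁ ∈ Γ(D₊(x_l))`
  obtain ⟨⟨σ₁, ⟨_, n, rfl⟩⟩, hσ₁⟩ := IsLocalization.surj (Submonoid.powers r)
    ((P d K).presheaf.map (homOfLE (hrV.trans inf_le_left)).op σ)
  simp only [RingHom.algebraMap_toAlgebra, map_pow] at hσ₁
  change (P d K).presheaf.map (homOfLE (hrV.trans inf_le_left)).op σ *
    (P d K).presheaf.map (homOfLE hrU).op r ^ n = (P d K).presheaf.map (homOfLE hrU).op σ₁ at hσ₁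
  -- read in `K(ℙ^d)`
  have hξr : genericPoint (P d K) ∈ (P d K).basicOpen r := genericPoint_mem_of_mem hyr
  have key : ofSection hξr ((P d K).presheaf.map (homOfLE (hrV.trans inf_le_left)).op σ) *
      ofSection hξr ((P d K).presheaf.map (homOfLE hrU).op r) ^ n =
      ofSection hξr ((P d K).presheaf.map (homOfLE hrU).op σ₁) := by
    have h := congrArg ((P d K).presheaf.germ _ (genericPoint (P d K)) hξr).hom hσ₁
    rwa [map_mul, map_pow] at h
  rw [ofSection_map, ofSection_map, ofSection_map] at key
  -- `ofSection σ = a`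
  have hσa : ofSection ((homOfLE (hrV.trans inf_le_left)).le hξr) σ = toFunctionField y u := by
    rw [← hσ]
    exact ofSection_eq_toFunctionField hyV σ
  rw [hσa] at key
  -- `r` and `σ₁` come from degree-zero fractions
  obtain ⟨b₂, hb₂⟩ := (sec_bijective l).2 r
  obtain ⟨b₁, hb₁⟩ := (sec_bijective l).2 σ₁
  have hρ : ofSection ((homOfLE hrU).le hξr) r = awayToFunctionField l b₂ := by
    rw [awayToFunctionField_apply, hb₂]
  have hτ : ofSection ((homOfLE hrU).le hξr) σ₁ = awayToFunctionField l b₁ := by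
    rw [awayToFunctionField_apply, hb₁]
  rw [hρ, hτ] at key
  -- units at `y`
  have hρu : IsUnitAt y (awayToFunctionField l b₂) := by
    rw [← hρ]
    exact (isUnitAt_ofSection_iff (hrU hyr) r).2 (by
      have : (P d K).basicOpen ((P d K).presheaf.map (homOfLE hrU).op r) = (P d K).basicOpen r := by
        rw [Scheme.basicOpen_res, inf_idem]
      simpa only using hyr)
  have hτu : IsUnitAt y (awayToFunctionField l b₁) := by
    rw [← key]
    exact IsUnitAt.mul ⟨u, rfl⟩ (hρu.pow n)
  -- numerator and denominator as forms, degrees equalised and made positive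
  obtain ⟨e₁, F₁, hF₁, rfl⟩ := Away.mk_surjective (grading (Fin (d + 1)) K) (X_mem K l) b₁
  obtain ⟨e₂, F₂, hF₂, hb₂n⟩ := Away.mk_surjective (grading (Fin (d + 1)) K) (X_mem K l) (b₂ ^ n)
  have hF₁' : F₁ ∈ grading (Fin (d + 1)) K e₁ := by simpa using hF₁
  have hF₂' : F₂ ∈ grading (Fin (d + 1)) K e₂ := by simpa using hF₂
  refine ⟨e₁ + (e₂ + 1), F₁ * X l ^ (e₂ + 1), F₂ * X l ^ (e₁ + 1), by omega,
    mul_X_pow_mem hF₁' _, ?_, ?_, ?_, ?_⟩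
  · rw [show e₁ + (e₂ + 1) = e₂ + (e₁ + 1) by ring]
    exact mul_X_pow_mem hF₂' _
  · rw [← isUnitAt_formToFunctionField_iff l (by omega) (mul_X_pow_mem hF₁' _) hy,
      formToFunctionField_of_mem l (mem_smul_one (mul_X_pow_mem hF₁' _)), awayMk_mul_X_pow l hF₁]
    exact hτu
  · have hmem : F₂ * X l ^ (e₁ + 1) ∈ grading (Fin (d + 1)) K (e₂ + (e₁ + 1)) := mul_X_pow_mem hF₂' _
    rw [← isUnitAt_formToFunctionField_iff l (by omega) hmem hy,
      formToFunctionField_of_mem l (mem_smul_one hmem), awayMk_mul_X_pow l hF₂, hb₂n, map_pow]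
    exact hρu.pow n
  · have hmem : F₂ * X l ^ (e₁ + 1) ∈ grading (Fin (d + 1)) K (e₂ + (e₁ + 1)) := mul_X_pow_mem hF₂' _
    have hmem' : F₂ * X l ^ (e₁ + 1) ∈ grading (Fin (d + 1)) K (e₁ + (e₂ + 1)) := by
      rw [show e₁ + (e₂ + 1) = e₂ + (e₁ + 1) by ring]; exact hmem
    rw [← formToFunctionField_div_eq l (mul_X_pow_mem hF₁' _) hmem',
      formToFunctionField_of_mem l (mem_smul_one (mul_X_pow_mem hF₁' _)), awayMk_mul_X_pow l hF₁,
      formToFunctionField_of_mem l (mem_smul_one hmem), awayMk_mul_X_pow l hF₂, hb₂n, map_pow,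
      eq_div_iff (pow_ne_zero _ hρu.ne_zero)]
    exact key


/-! ### The divisor `V₊(F) = e • H + div(F/x₀ᵉ)` of a form of degree `e` -/

/-- **The hypersurface `V₊(F)` as a Cartier divisor on `ℙ^d`**: for a nonzero form `F` of degree
`e`, the divisor `e • H + div(F/x₀ᵉ)` — the divisor of zeros of the section `F/x₀ᵉ ∈ Γ(ℙ^d, 𝒪(e • H))`
(`isSection_formToFunctionField`), with local equation `F/x_lᵉ` on `D₊(x_l)` (`formDivisor_f`). It is
effective, linearly equivalent to `e • H`, and its support is `V₊(F)` (`formDivisor_avoids_iff`)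
(Görtz–Wedhorn I, Example 11.45: divisors on `ℙⁿ_k` and `𝒪(n)`; Hartshorne II Prop. 7.7 (a): the
divisor of zeros of a section). [folklore] -/
def formDivisor {e : ℕ} (F : MvPolynomial (Fin (d + 1)) K) (hF : F ∈ grading (Fin (d + 1)) K e)
    (hF0 : F ≠ 0) : CartierDivisor (P d K) :=
  e • hyperplane d K +
    CartierDivisor.principal (formToFunctionField 0 F) (formToFunctionField_ne_zero 0 hF hF0)

variable {e : ℕ} {F : MvPolynomial (Fin (d + 1)) K} (hF : F ∈ grading (Fin (d + 1)) K e) (hF0 : F ≠ 0)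

/-- The charts of `formDivisor F` are those of `H` (times a point): `(i, ⋆) ↦ D₊(x_{i})`. [folklore] -/
theorem mem_formDivisor_U_iff (p : (formDivisor F hF hF0).ι) {y : P d K} :
    y ∈ (formDivisor F hF hF0).U p ↔ y ∈ U p.1.down.1 := by
  change y ∈ (e • hyperplane d K).U p.1 ⊓ ⊤ ↔ _
  rw [Opens.mem_inf, CartierDivisor.smul_U, hyperplane_U]
  exact ⟨fun h => h.1, fun h => ⟨h, trivial⟩⟩

/-- **The local equation of `V₊(F)` on `D₊(x_l)` is `F/x_lᵉ`.** [folklore] -/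
theorem formDivisor_f (p : (formDivisor F hF hF0).ι) :
    (formDivisor F hF hF0).f p = formToFunctionField p.1.down.1 F := by
  change (hyperplane d K).f p.1 ^ e * formToFunctionField 0 F = _
  exact hyperplane_f_pow_mul_formToFunctionField p.1 hF

/-- `V₊(F)` is an effective divisor (`F/x₀ᵉ` is a section of `𝒪(e • H)`, Görtz–Wedhorn I, (11.12.3)).
[folklore] -/
theorem isEffective_formDivisor : (formDivisor F hF hF0).IsEffective :=
  (CartierDivisor.isEffective_add_principal_iff _).2 (isSection_formToFunctionField hF)

/-- `V₊(F) ∼ e • H` (they differ by the principal divisor `div(F/x₀ᵉ)`). [folklore] -/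
theorem smul_hyperplane_linEquiv_formDivisor : (e • hyperplane d K).LinEquiv (formDivisor F hF hF0) :=
  ⟨_, _, CartierDivisor.SameDivisor.refl _⟩

/-- **The support of `V₊(F)` is `V₊(F)`**: for `e ≥ 1`, the divisor `formDivisor F` avoids `y` iff
`F ∉ 𝔭_y`. [folklore] -/
theorem formDivisor_avoids_iff (he : 0 < e) {y : P d K} :
    (formDivisor F hF hF0).Avoids y ↔ F ∉ y.asHomogeneousIdeal := by
  obtain ⟨i, hy⟩ := (hyperplane d K).covers y
  rw [hyperplane_U] at hy
  have hy' : y ∈ (formDivisor F hF hF0).U (i, PUnit.unit) := (mem_formDivisor_U_iff hF hF0 _).2 hy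
  constructor
  · intro h
    have h1 := h _ hy'
    rw [formDivisor_f] at h1
    exact (isUnitAt_formToFunctionField_iff _ he hF hy).1 h1
  · intro h
    refine CartierDivisor.Avoids.of_mem hy' ?_
    rw [formDivisor_f]
    exact (isUnitAt_formToFunctionField_iff _ he hF hy).2 h

/-- For a linear form `ℓ ≠ 0`, **the hyperplane `V₊(ℓ)` is linearly equivalent to `H = V₊(x₀)`**.
[folklore] -/
theorem hyperplane_linEquiv_formDivisor {ℓ : MvPolynomial (Fin (d + 1)) K}
    (hℓ : ℓ ∈ grading (Fin (d + 1)) K 1) (hℓ0 : ℓ ≠ 0) : (hyperplane d K).LinEquiv (formDivisor ℓ hℓ hℓ0) := by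
  have h := smul_hyperplane_linEquiv_formDivisor hℓ hℓ0
  rwa [CartierDivisor.one_smul] at h

/-- Every point of `ℙ^d` is avoided by one of the coordinate hyperplanes `V₊(x_l)` (the `D₊(x_l)`
cover). [folklore] -/
theorem exists_formDivisor_X_avoids (y : P d K) :
    ∃ l : Fin (d + 1), (formDivisor (X l) (X_mem K l) (MvPolynomial.X_ne_zero l)).Avoids y := by
  obtain ⟨i, hy⟩ := (hyperplane d K).covers y
  refine ⟨i.down.1, (formDivisor_avoids_iff (X_mem K _) _ zero_lt_one).2 ?_⟩
  rw [hyperplane_U, mem_U_iff, Proj.mem_basicOpen] at hy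
  exact hy


/-! ### Generic hyperplanes: a linear form outside finitely many points -/

/-- Every point of `ℙ^d` lies off some coordinate hyperplane: some `x_l ∉ 𝔭_y` (the prime `𝔭_y` is
relevant). [folklore] -/
theorem exists_X_notMem (y : P d K) : ∃ l : Fin (d + 1), (X l : MvPolynomial (Fin (d + 1)) K) ∉
    y.asHomogeneousIdeal := by
  by_contra h
  push Not at h
  apply y.not_irrelevant_le
  intro p hp
  have hp' : p ∈ Ideal.span (Set.range (X : Fin (d + 1) → MvPolynomial (Fin (d + 1)) K)) :=
    irrelevant_le_span_X (Fin (d + 1)) K hp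
  refine (Ideal.span_le.2 ?_) hp'
  rintro _ ⟨l, rfl⟩
  exact h l

/-- **A linear form avoiding finitely many points** (`K` infinite): for a finite set `B ⊆ ℙ^d` there is
a nonzero linear form `ℓ` with `ℓ ∉ 𝔭_b` for all `b ∈ B`, i.e. a hyperplane `V₊(ℓ)` through no point
of `B` (a vector space over an infinite field is not a finite union of proper subspaces, Mathlib
`Submodule.exists_forall_notMem_of_forall_ne_top`, applied to the traces `𝔭_b ∩ K[x]₁ ⊊ K[x]₁`).
[folklore] -/
theorem exists_linearForm_forall_notMem [Infinite K] {B : Set (P d K)} (hB : B.Finite) :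
    ∃ ℓ : MvPolynomial (Fin (d + 1)) K, ℓ ∈ grading (Fin (d + 1)) K 1 ∧ ℓ ≠ 0 ∧
      ∀ b ∈ B, ℓ ∉ b.asHomogeneousIdeal := by
  haveI : Finite B := hB.to_subtype
  let V : Submodule K (MvPolynomial (Fin (d + 1)) K) := grading (Fin (d + 1)) K 1
  let p : Option B → Submodule K V := fun o => o.elim ⊥ fun b =>
    (b.1.asHomogeneousIdeal.toIdeal.restrictScalars K).comap V.subtype
  have hp : ∀ o, p o ≠ ⊤ := by
    rintro (_ | b)
    · change (⊥ : Submodule K V) ≠ ⊤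
      intro h
      have hx : (⟨X 0, X_mem K 0⟩ : V) ∈ (⊥ : Submodule K V) := by rw [h]; trivial
      rw [Submodule.mem_bot] at hx
      exact MvPolynomial.X_ne_zero (0 : Fin (d + 1)) (congrArg Subtype.val hx)
    · obtain ⟨l, hl⟩ := exists_X_notMem b.1
      intro h
      have hx : (⟨X l, X_mem K l⟩ : V) ∈ p (some b) := by rw [h]; trivial
      exact hl hx
  obtain ⟨x, hx⟩ := Submodule.exists_forall_notMem_of_forall_ne_top p hp
  refine ⟨x.1, x.2, fun h0 => hx none ?_, fun b hb h => hx (some ⟨b, hb⟩) h⟩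
  change x ∈ (⊥ : Submodule K V)
  rw [Submodule.mem_bot]
  exact Subtype.ext h0

end ProjSpace

end Literature.AlgebraicGeometry.Motives

end
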